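import Summits.BirchSwinnertonDyer.BirchSwinnertonDyer.Theorems.GenusKolyvaginAtTwoPowDvdShaCardAtTwoRTBottomRungClosure
import Summits.BirchSwinnertonDyer.BirchSwinnertonDyer.Theorems.CMKolyvaginAtInertTwoLowerEngineDeepAtTwo
import Summits.BirchSwinnertonDyer.BirchSwinnertonDyer.Theorems.CMKolyvaginAtInertTwoLowerRungSupplyAtTwo
import HarnessLib

/-!
# Route `CMKolyvaginAtInertTwo`, crux `CMKolyvaginExactAtInertTwo` (stmt-BirchSwinnertonDyer-24277), `stub_lower` —
# PORT OF gk2's LINE 18, FILE C1b: THE BOTTOM RUNG (Gross witness ⟹ all-deep 2-primitive product) ON THE CM-INERT HABITAT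

Seat `bsd-line-cmk2-p1` g19 (cell `bsd-print-cf2`), `--supports stmt-BirchSwinnertonDyer-24277` (helper; closes nothing).
THEOREMS ONLY (no definition, no named fact, no `sorry`).  BSD is NOT proved by any of this; the crux is not closed here.

WHAT.  LEAD gk2-p1 g17's `RelaxedCount.exists_deep_primitive_of_gross_witness` (`…RTBottomRungClosure`): McCallum's prime-swapping at the
bottom of the ladder — from a level-`4` Gross witness `(n₀, e₀)` to a 2-primitive square-free product of DEEP primes (index `≥ L`,
`Frob = Frob_∞` on `K(E[2^L])`) of the same length — by gk2-p4's k-minimal loop over the one-step engine.  Its image binders enter through the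
engine's pair Čebotarev (file C1a `CMKolyvaginAtInertTwoLowerEngineDeepAtTwo`: on H₂ no (NPh)), through Q2 (file A, per instance from Gross
1991 Prop. 3.7 (2)) and through `hA` inside Gross 6.2 (1) (replaced by the image-free `P2.TamagawaSelmerAtTwo` leaf).  This file is the
closure re-threaded; the (V44)-socket `hTr` stays displayed as in gk2's statement.  Proof VERBATIM otherwise (credit LEAD gk2-p1 g17, gk2-p4).

References: [McCallumLMS1991] §5 proof of Prop. 5.2, §4 Lemma 4.3, Prop. 4.4; [Kolyvagin1991MathAnn] Thm. 2.2; [GrossLMS1991] §3 (3.1)–(3.3),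
Prop. 3.7 (2), §4, Prop. 6.2, §9.
-/

set_option autoImplicit false
-- the Theorems namespace of this sub repeats the summit name by design (D-0017 nested layout)
set_option linter.dupNamespace false

noncomputable section

open scoped Classical

open Field NumberField IsDedekindDomain Function WeierstrassCurve Rat.HeightOneSpectrum
open Literature.NumberTheory.EllipticCurves
open Literature.NumberTheory.GaloisRepresentations
open Literature.NumberTheory.GaloisCohomology
open Literature.NumberTheory.EllipticCurves.GrossLMS1991 (prop37_2_reductionCongruence_inert)
open Summit.BirchSwinnertonDyer.Rank1Residual.X11b.Relaxation
open Summit.BirchSwinnertonDyer.Rank1Residual (X11b.KolyvaginAssembly.discr_lt_neg_four JET.exists_compatible_data_of_grossCM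
  JET.exists_compatible_datum_of_dvd_of_grossCM)
open Summit.BirchSwinnertonDyer.BirchSwinnertonDyer.Theorems.GenusExact
open Summit.BirchSwinnertonDyer.BirchSwinnertonDyer.Theorems.GenusExact.RelaxedCount
open Summit.BirchSwinnertonDyer.BirchSwinnertonDyer.Theorems.GenusExact.SelmerDescent (inertiaDeg_eq_two_of_span_isPrime)
open Summit.BirchSwinnertonDyer.BirchSwinnertonDyer.Theorems.GenusExact.VisiblePairAtTwo
  (natCast_mem_primesEquiv_symm natGenerator_eq_of_natCast_prime_mem natCast_prime_mem_iff_eq liesOver_of_natCast_mem natCast_mem_of_liesOver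
    exists_natCast_mem intCast_notMem_of_not_dvd)

namespace Summit.BirchSwinnertonDyer.BirchSwinnertonDyer.Theorems.KolyvaginLowerTwo

/-- **THE BOTTOM RUNG (level-4 Gross witness ⟹ all-deep primitive product) ON THE CM-INERT HABITAT, modulo the (V44)-socket and Gross 3.7 (2).**
LEAD gk2-p1 g17's `RelaxedCount.exists_deep_primitive_of_gross_witness` with `(hQ2) (hcm) (hΔ) (hρ) (hns) (hNPh)` replaced by
`(hCM) (hin) (hρ2) (h37)`: the k-minimal loop (gk2-p4 `PlusDescent.exists_all_deep_of_engine_card`) over file C1a's engine (no non-phantom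
hypothesis on H₂), Gross Prop. 6.2 (1) at `2` from the image-free `P2.TamagawaSelmerAtTwo.kolyvaginClass_mem_selmerLocalKer_two_pow_of_not_mem`,
Q2 per instance from file A.  Displayed: the (V44)-socket `hTr` (McCallum Prop. 4.4 (1) at `2` at the deep own primes; gk2-p3's
`hTr_of_three_le` discharges it for `L ≥ 3`), and the WITNESS: a square-free `n₀` of Zhang–Kolyvagin primes of index `≥ 2` with `Frob = Frob_∞`
on `K(E[4])`, a datum `e₀` with `addOrderOf c₂(e₀) = 4`, and the parity `−w(E)·(−1)^{ω(n₀)+1} = 1`.  THEN a square-free `n`, `ω(n) = ω(n₀)`, ALL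
of whose primes are Zhang–Kolyvagin of index `≥ L` with `Frob = Frob_∞` on `K(E[2^L])`, with a datum `e` at `n` of `addOrderOf c₂(e) = 4`.
Proof VERBATIM (credit LEAD gk2-p1 g17, gk2-p4).  [cite: McCallumLMS1991, §5 proof of Prop. 5.2; §4 Lemma 4.3, Prop. 4.4]
[cite: Kolyvagin1991MathAnn, Thm. 2.2] [cite: GrossLMS1991, Prop. 3.7 (2), Prop. 6.2] -/
theorem exists_deep_primitive_of_gross_witness (W : WeierstrassCurve ℚ) [W.IsElliptic] [W.IsGloballyMinimal] [NeZero (W.conductorNorm ℤ)]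
    (hCM : W.HasCM) (hin : Rank1Residual.CMInert W 2) (hρ2 : W.HasSurjectiveModNGaloisRep 2) (hT : Odd W.tamagawaProduct)
    {K : Type} [Field K] [NumberField K] (hK : IsImaginaryQuadratic K) (hodd : Odd (NumberField.discr K))
    (h3 : NumberField.discr K ≠ -3) (hHe : SatisfiesHeegnerHypothesis (W.conductorNorm ℤ) K)
    (h37 : prop37_2_reductionCongruence_inert (W.conductorNorm ℤ) W K)
    (Dt : ModularForms.ModularParametrizationData W (W.conductorNorm ℤ)) (β : ℤ) (ι : K →+* ℂ)
    {L : ℕ} (hL2 : 2 ≤ L)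
    (hTr : ∀ (n' : ℕ) (d' : KolyvaginHeegnerData Dt β ι n') (Z : galoisCohomology (W.torsionGaloisModule ((2 ^ 2 : ℕ) : ℤ)) 1),
      Squarefree n' →
      (∀ q ∈ n'.primeFactors, Zhang2014.IsKolyvaginPrime (W.conductorNorm ℤ) W K 2 q ∧ 2 ≤ Zhang2014.kolyvaginIndex W 2 q ∧
        FrobEqFrobInfty W K (2 ^ 2) q) →
      resTorsion W K ((2 ^ 2 : ℕ) : ℤ) Z = d'.kolyvaginClass Nat.prime_two 2 →
      ∀ (v : HeightOneSpectrum (𝓞 ℚ)) (ℓ : ℕ), ℓ ∈ n'.primeFactors → (ℓ : 𝓞 ℚ) ∈ v.asIdeal →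
        L ≤ Zhang2014.kolyvaginIndex W 2 ℓ → FrobEqFrobInfty W K (2 ^ L) ℓ →
        ∀ 𝔓 ∈ v.primesAbove, ∀ F c₀ : absoluteGaloisGroup ℚ, IsArithFrobAt (𝓞 ℚ) F 𝔓 →
          IsComplexConjugation (Rat.castHom ℝ) c₀ → (∀ P : geomTorsion W ((2 ^ 2 : ℕ) : ℤ), F • P = c₀ • P) →
          ∃ P₁ : geomTorsion W ((2 ^ 2 : ℕ) : ℤ), h1Eval W _ ((2 : ℕ) • Z) F = F • P₁ - P₁)
    -- the witness
    {n₀ : ℕ} (hn₀ : Squarefree n₀)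
    (hn₀K : ∀ q ∈ n₀.primeFactors, Zhang2014.IsKolyvaginPrime (W.conductorNorm ℤ) W K 2 q ∧ 2 ≤ Zhang2014.kolyvaginIndex W 2 q ∧
      FrobEqFrobInfty W K (2 ^ 2) q)
    (e₀ : KolyvaginHeegnerData Dt β ι n₀) (he₀ : addOrderOf (e₀.kolyvaginClass Nat.prime_two 2) = 2 ^ 2)
    (hpar : -W.rootNumber * (-1) ^ (n₀.primeFactors.card + 1) = 1) :
    ∃ (n : ℕ) (e : KolyvaginHeegnerData Dt β ι n), Squarefree n ∧ n.primeFactors.card = n₀.primeFactors.card ∧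
      (∀ q ∈ n.primeFactors, Zhang2014.IsKolyvaginPrime (W.conductorNorm ℤ) W K 2 q ∧ L ≤ Zhang2014.kolyvaginIndex W 2 q ∧
        FrobEqFrobInfty W K (2 ^ L) q) ∧
      addOrderOf (e.kolyvaginClass Nat.prime_two 2) = 2 ^ 2 := by
  haveI : Fact (Nat.Prime 2) := ⟨Nat.prime_two⟩
  have h2K : Module.finrank ℚ K = 2 := hK.1
  have h4 : NumberField.discr K ≠ -4 := fun h ↦ by
    rw [h] at hodd
    exact (Int.not_even_iff_odd.mpr hodd) ⟨-2, by norm_num⟩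
  have hD : NumberField.discr K < -4 := X11b.KolyvaginAssembly.discr_lt_neg_four hK ⟨h3, h4⟩
  have hsurj1 : W.HasSurjectiveModNGaloisRep ((2 : ℤ) ^ 1) := by simpa using hρ2
  have h12 : (1 : ℕ) ≤ 2 := by norm_num
  have hGrossCM := phi_heegnerPointOfConductor_mem_range_map_ringClassField_holds (W.conductorNorm ℤ) W K
  -- `K = ℚ(θ)`, `θ² = d_K`; the conjugation `σ`
  obtain ⟨θ, hθ', hθsq⟩ := Literature.NumberTheory.QuadraticFields.Quadratic.exists_not_mem_range_sq_eq_discr (K := K) h2K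
  have hθ : θ ∉ (algebraMap ℚ K).range := fun ⟨q, hq⟩ ↦ hθ' ⟨q, hq⟩
  have hc : θ ^ 2 = algebraMap ℚ K (NumberField.discr K : ℤ) := hθsq
  set σ : K ≃ₐ[ℚ] K := sigmaQ K h2K hθ' hθsq with hσ_def
  have hσ : σ ≠ 1 := sigmaQ_ne_one K h2K hθ' hθsq
  have hL4 : ∀ P : (W.baseChange K).toAffine.Point, ((2 ^ 2 : ℕ) : ℤ) • P = 0 → P = 0 :=
    EigenClassesFinite.forall_zsmul_two_pow_baseChange_eq_zero_of_hasSurjectiveModNGaloisRep_two W K h2K hρ2 2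
  -- the predicates of the loop
  let Gross : ℕ → Prop := fun q ↦ Zhang2014.IsKolyvaginPrime (W.conductorNorm ℤ) W K 2 q ∧ 2 ≤ Zhang2014.kolyvaginIndex W 2 q ∧
    FrobEqFrobInfty W K (2 ^ 2) q
  let Deep : ℕ → Prop := fun q ↦ Zhang2014.IsKolyvaginPrime (W.conductorNorm ℤ) W K 2 q ∧ L ≤ Zhang2014.kolyvaginIndex W 2 q ∧
    FrobEqFrobInfty W K (2 ^ L) q
  have hDeepGross : ∀ q, Deep q → Gross q := fun q hq ↦ ⟨hq.1, hL2.trans hq.2.1, hq.2.2.of_dvd (pow_dvd_pow 2 hL2)⟩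
  let P : Finset ℕ → Prop := fun S ↦ ∃ (n : ℕ) (e : KolyvaginHeegnerData Dt β ι n), Squarefree n ∧ n.primeFactors = S ∧
    (∀ q ∈ n.primeFactors, Gross q) ∧ addOrderOf (e.kolyvaginClass Nat.prime_two 2) = 2 ^ 2
  -- ### run the loop
  suffices hloop : ∃ S, S.card = n₀.primeFactors.card ∧ P S ∧ ∀ l ∈ S, Deep l by
    obtain ⟨S, hScard, ⟨n, e, hn, hpf, hGr, he⟩, hdeep⟩ := hloop
    refine ⟨n, e, hn, by rw [hpf, hScard], fun q hq ↦ ?_, he⟩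
    exact hdeep q (hpf ▸ hq)
  refine PlusDescent.exists_all_deep_of_engine_card Deep P n₀.primeFactors.card ?_ n₀.primeFactors rfl ⟨n₀, e₀, hn₀, rfl, hn₀K, he₀⟩
  -- ### the engine step
  intro S hScard hPS q₀ hq₀S hq₀ hno
  obtain ⟨n, e, hn, hpf, hGr, he⟩ := hPS
  subst hpf
  have hn0 : n ≠ 0 := hn.ne_zero
  have hnK : ∀ q ∈ n.primeFactors, Zhang2014.IsKolyvaginPrime (W.conductorNorm ℤ) W K 2 q ∧ 2 ≤ Zhang2014.kolyvaginIndex W 2 q :=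
    fun q hq ↦ ⟨(hGr q hq).1, (hGr q hq).2.1⟩
  -- places of the own primes: free `s` (non-deep) and deep `t`
  let pl : ℕ → Place ℚ := fun q ↦ if hq : q.Prime then Sum.inr (primesEquiv.symm ⟨q, hq⟩) else Sum.inr (primesEquiv.symm ⟨2, Nat.prime_two⟩)
  have hpl : ∀ {q : ℕ} (hq : q.Prime), pl q = Sum.inr (primesEquiv.symm ⟨q, hq⟩) := fun hq ↦ by simp only [pl, dif_pos hq]
  have hplmem : ∀ {q : ℕ} (hq : q.Prime), (q : 𝓞 ℚ) ∈ (primesEquiv.symm ⟨q, hq⟩ : HeightOneSpectrum (𝓞 ℚ)).asIdeal :=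
    fun hq ↦ natCast_mem_primesEquiv_symm hq
  let s : Finset (Place ℚ) := (n.primeFactors.filter fun q ↦ ¬ Deep q).image pl
  let t : Finset (Place ℚ) := (n.primeFactors.filter fun q ↦ Deep q).image pl
  -- reading a place of `s ∪ t` back to its prime
  have hback : ∀ u ∈ s ∪ t, ∃ q ∈ n.primeFactors, u = pl q := by
    intro u hu
    rcases Finset.mem_union.mp hu with hu | hu
    · obtain ⟨q, hq, rfl⟩ := Finset.mem_image.mp hu
      exact ⟨q, (Finset.mem_filter.mp hq).1, rfl⟩
    · obtain ⟨q, hq, rfl⟩ := Finset.mem_image.mp hu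
      exact ⟨q, (Finset.mem_filter.mp hq).1, rfl⟩
  have hpl_inj : ∀ {q q' : ℕ}, q.Prime → q'.Prime → pl q = pl q' → q = q' := by
    intro q q' hq hq' h
    rw [hpl hq, hpl hq'] at h
    have h' := Sum.inr_injective h
    have := congrArg (fun v : HeightOneSpectrum (𝓞 ℚ) ↦ (primesEquiv v : ℕ)) h'
    simpa using this
  have hmem_st : ∀ q ∈ n.primeFactors, pl q ∈ s ∪ t := by
    intro q hq
    by_cases hd : Deep q
    · exact Finset.mem_union_right _ (Finset.mem_image.mpr ⟨q, Finset.mem_filter.mpr ⟨hq, hd⟩, rfl⟩)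
    · exact Finset.mem_union_left _ (Finset.mem_image.mpr ⟨q, Finset.mem_filter.mpr ⟨hq, hd⟩, rfl⟩)
  -- ### the engine's hypotheses
  have hst : Disjoint s t := by
    rw [Finset.disjoint_left]
    intro u hus hut
    obtain ⟨q, hq, rfl⟩ := Finset.mem_image.mp hus
    obtain ⟨q', hq', h⟩ := Finset.mem_image.mp hut
    obtain ⟨hqn, hqd⟩ := Finset.mem_filter.mp hq
    obtain ⟨hq'n, hq'd⟩ := Finset.mem_filter.mp hq'
    have := hpl_inj (Nat.prime_of_mem_primeFactors hq'n) (Nat.prime_of_mem_primeFactors hqn) h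
    exact hqd (this ▸ hq'd)
  have hs : s.Nonempty := ⟨pl q₀, Finset.mem_image.mpr ⟨q₀, Finset.mem_filter.mpr ⟨hq₀S, hq₀⟩, rfl⟩⟩
  have hTK : ∀ u ∈ s ∪ t, ∃ (v : HeightOneSpectrum (𝓞 ℚ)) (ℓ : ℕ) (_ : Fact ℓ.Prime), u = Sum.inr v ∧ ℓ ≠ 2 ∧ (ℓ : 𝓞 ℚ) ∈ v.asIdeal ∧
      W.HasGoodReductionAtPrime ℓ ∧ FrobEqFrobInfty W K 2 ℓ ∧ 2 ≤ Zhang2014.kolyvaginIndex W 2 ℓ ∧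
      Zhang2014.IsKolyvaginPrime (W.conductorNorm ℤ) W K 2 ℓ := by
    intro u hu
    obtain ⟨q, hq, rfl⟩ := hback u hu
    have hqp : q.Prime := Nat.prime_of_mem_primeFactors hq
    obtain ⟨hKol, hidx, hFrob4⟩ := hGr q hq
    haveI : Fact q.Prime := ⟨hqp⟩
    exact ⟨_, q, ⟨hqp⟩, hpl hqp, hKol.2.2.2.1, hplmem hqp, hasGoodReductionAtPrime_of_not_dvd_conductorNorm W hKol.2.1,
      hFrob4.of_dvd ⟨2, by norm_num⟩, hidx, hKol⟩
  have ht4 : ∀ (v : HeightOneSpectrum (𝓞 ℚ)) (ℓ : ℕ), ℓ.Prime → Sum.inr v ∈ t → (ℓ : 𝓞 ℚ) ∈ v.asIdeal →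
      FrobEqFrobInfty W K (2 ^ 2) ℓ := by
    intro v ℓ hℓp hvt hℓv
    obtain ⟨q, hq, h⟩ := Finset.mem_image.mp hvt
    obtain ⟨hqn, hqd⟩ := Finset.mem_filter.mp hq
    have hqp : q.Prime := Nat.prime_of_mem_primeFactors hqn
    rw [hpl hqp] at h
    have hv : v = primesEquiv.symm ⟨q, hqp⟩ := (Sum.inr_injective h).symm
    have hℓq : ℓ = q := by
      have h1 := natGenerator_eq_of_natCast_prime_mem hℓp hℓv
      have h2 := natGenerator_eq_of_natCast_prime_mem hqp (hv ▸ hplmem hqp)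
      exact h1.symm.trans h2
    subst hℓq
    exact hqd.2.2.of_dvd (pow_dvd_pow 2 hL2)
  -- the class `c₂(n)`: order `4`, eigen, Selmer off `n`
  set cK := e.kolyvaginClass Nat.prime_two 2 with hcK_def
  obtain ⟨hsgn, hτcK⟩ := KolyvaginClassSign.sign_conjAct_kolyvaginClass_two hK h3 h4 hodd hHe hsurj1 σ hσ Dt β ι hn h12 hnK e
  refine KolyvaginLowerTwo.false_of_bottomRung_engine_deep' W hCM hin hρ2 hK hHe hθ hc σ hσ hL2 s t hst hs hTK ht4 cK he hsgn hτcK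
    fun y _ _ ↦ ⟨∅, ?_⟩
  -- ### the bookkeeping at a deep new prime `ℓ′`
  intro ℓ' v' w' hw'v' _ hℓ'p hℓ'v' hℓ'w' hKol' hFrobL hidxL hv'out hOrdZ hOrdY
  have hdeep' : Deep ℓ' := ⟨hKol', hidxL, hFrobL⟩
  have hGross' : Gross ℓ' := hDeepGross ℓ' hdeep'
  have hv'eq : v' = primesEquiv.symm ⟨ℓ', hℓ'p⟩ := (natCast_prime_mem_iff_eq hℓ'p _).mp hℓ'v'
  have hℓ'n : ℓ' ∉ n.primeFactors := fun h ↦ hv'out (by rw [hv'eq, ← hpl hℓ'p]; exact hmem_st ℓ' h)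
  have hℓ'dvd : ¬ ℓ' ∣ n := fun h ↦ hℓ'n (Nat.mem_primeFactors.mpr ⟨hℓ'p, h, hn0⟩)
  have hsq : Squarefree (n * ℓ') :=
    (Nat.squarefree_mul ((Nat.Prime.coprime_iff_not_dvd hℓ'p).mpr hℓ'dvd).symm).mpr ⟨hn, hℓ'p.squarefree⟩
  have hpf' : (n * ℓ').primeFactors = insert ℓ' n.primeFactors := by
    rw [Nat.primeFactors_mul hn0 hℓ'p.ne_zero, hℓ'p.primeFactors, Finset.union_comm]; rfl
  have hGr' : ∀ q ∈ (n * ℓ').primeFactors, Gross q := by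
    intro q hq
    rw [hpf', Finset.mem_insert] at hq
    rcases hq with rfl | hq
    · exact hGross'
    · exact hGr q hq
  have hnK' : ∀ q ∈ (n * ℓ').primeFactors, Zhang2014.IsKolyvaginPrime (W.conductorNorm ℤ) W K 2 q ∧ 2 ≤ Zhang2014.kolyvaginIndex W 2 q :=
    fun q hq ↦ ⟨(hGr' q hq).1, (hGr' q hq).2.1⟩
  have hcard' : (n * ℓ').primeFactors.card = n.primeFactors.card + 1 := by
    rw [hpf', Finset.card_insert_of_notMem hℓ'n]
  -- the datum at `nℓ′` (Gross's CM construction) and its class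
  obtain ⟨dℓ, hdℓ⟩ := JET.exists_compatible_data_of_grossCM hGrossCM hK hD hHe 2 Dt β ι hn (fun q hq ↦ (hnK q hq).1) e
  obtain ⟨hσc, hSc, hSc', hembc⟩ := hdℓ ℓ' hKol' hℓ'n
  set d' := dℓ ℓ' hKol' hℓ'n with hd'_def
  set cK' := d'.kolyvaginClass Nat.prime_two 2 with hcK'_def
  -- (desc): `cK′` is `σ`-fixed (parity), hence a restriction from `ℚ`
  obtain ⟨-, hτcK'⟩ := KolyvaginClassSign.sign_conjAct_kolyvaginClass_two hK h3 h4 hodd hHe hsurj1 σ hσ Dt β ι hsq h12 hnK' d'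
  have hsign' : -W.rootNumber * (-1) ^ (n * ℓ').primeFactors.card = 1 := by rw [hcard', hScard]; exact hpar
  rw [hsign', one_smul] at hτcK'
  obtain ⟨Z, hZ⟩ := (EigenClassesFinite.mem_range_resTorsion_iff_conjAct_eq W K h2K hθ' hθsq _ hL4 cK').mpr hτcK'
  refine ⟨Z, cK', hZ, ?_, ?_, ?_, ?_⟩
  · -- (Kum): `cK′` Selmer at the places not over `nℓ′`
    intro v hv w hwv
    haveI := hwv
    refine Summit.BirchSwinnertonDyer.Rank1Residual.P2.TamagawaSelmerAtTwo.kolyvaginClass_mem_selmerLocalKer_two_pow_of_not_mem d' hK hHe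
      hT hsq.ne_zero 2 w
      (natCast_notMem_of_forall_primeFactors (K := K) hsq w fun q hq hqw ↦ hv ?_)
    have hqp : q.Prime := Nat.prime_of_mem_primeFactors hq
    have hqv : (q : 𝓞 ℚ) ∈ v.asIdeal := by
      rw [Ideal.LiesOver.over (P := w.asIdeal) (p := v.asIdeal), Ideal.under_def, Ideal.mem_comap, map_natCast]
      exact hqw
    have hveq : v = primesEquiv.symm ⟨q, hqp⟩ := (natCast_prime_mem_iff_eq hqp _).mp hqv
    rw [hpf', Finset.mem_insert] at hq
    rcases hq with rfl | hq
    · rw [hveq, ← hv'eq]; exact Finset.mem_insert_self _ _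
    · exact Finset.mem_insert_of_mem (by rw [hveq, ← hpl hqp]; exact hmem_st q hq)
  · -- (Q2@w′)
    intro j
    exact KolyvaginLowerTwo.kolyvaginRelationAtTwo_of_mul_eq W Dt β ι hρ2 hK h3 h4 hHe h37 2 rfl hsq hℓ'p hℓ'dvd hnK' e d' hσc hSc hSc'
      hembc w' hℓ'w' j
  · -- (free) + (M): at each free own prime `u = pl q`
    intro u hu
    obtain ⟨q, hqf, rfl⟩ := Finset.mem_image.mp hu
    obtain ⟨hq, hqd⟩ := Finset.mem_filter.mp hqf
    have hqp : q.Prime := Nat.prime_of_mem_primeFactors hq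
    obtain ⟨hKolq, -, hFrob4q⟩ := hGr q hq
    -- the swapped product `m = ℓ′·(n/q)` and a datum there coherent with `d′`
    have hq' : q ∈ (n * ℓ').primeFactors := by rw [hpf']; exact Finset.mem_insert_of_mem hq
    have hℓ'n' : ℓ' ∉ n.primeFactors := hℓ'n
    obtain ⟨hmsq, hqm, hmq, hmdvd, hmpf⟩ := squarefree_div_mul hn hq hℓ'p hℓ'n'
    obtain ⟨d'', hσ'', hS'', hS''', hemb''⟩ := JET.exists_compatible_datum_of_dvd_of_grossCM hK hD hHe 2 Dt β ι hsq (fun q hq ↦ (hnK' q hq).1)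
      hmdvd d'
    set cKu := d''.kolyvaginClass Nat.prime_two 2 with hcKu_def
    obtain ⟨w, hqw⟩ := exists_natCast_mem (K := K) hqp
    haveI hwv : w.asIdeal.LiesOver (primesEquiv.symm ⟨q, hqp⟩ : HeightOneSpectrum (𝓞 ℚ)).asIdeal :=
      liesOver_of_natCast_mem hqp (hplmem hqp) hqw
    -- Q2 at `w ∣ q` between `c₂(m)` and `c₂(nℓ′)`, second clause at `j = 1`
    have hRel := KolyvaginLowerTwo.kolyvaginRelationAtTwo_of_mul_eq W Dt β ι hρ2 hK h3 h4 hHe h37 2 hmq hsq hqp hqm hnK' d'' d' hσ'' hS''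
      hS''' hemb'' w hqw 1
    -- (M): every swap is imprimitive, so `2 • c₂(m) = 0`
    have hM : (2 : ℤ) • cKu = 0 := by
      have hnotP : ¬ P (insert ℓ' (n.primeFactors.erase q)) := hno q hq hqd ℓ' hdeep' hℓ'n
      have hne4 : addOrderOf cKu ≠ 2 ^ 2 := fun h4' ↦ hnotP ⟨ℓ' * (n / q), d'', hmsq, hmpf, fun r hr ↦ ?_, h4'⟩
      · have hdvd4 : addOrderOf cKu ∣ 2 ^ 2 := by
          rw [addOrderOf_dvd_iff_nsmul_eq_zero, ← natCast_zsmul]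
          exact zsmul_discreteH1_torsion _ _
        obtain ⟨k, hk2, hk⟩ := (Nat.dvd_prime_pow Nat.prime_two).mp hdvd4
        have hk1 : k ≤ 1 := by
          by_contra hk'
          exact hne4 (by rw [hk]; congr 1; omega)
        have hdvd2 : addOrderOf cKu ∣ 2 := by rw [hk]; exact (Nat.pow_dvd_pow 2 hk1).trans (by norm_num)
        have := addOrderOf_dvd_iff_nsmul_eq_zero.mp hdvd2
        rwa [← natCast_zsmul] at this
      · rw [hmpf, Finset.mem_insert] at hr
        rcases hr with rfl | hr
        · exact hGross'
        · exact hGr r (Finset.mem_of_mem_erase hr)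
    exact ⟨_, q, w, hwv, cKu, hpl hqp, hqp, hplmem hqp, intCast_notMem_of_not_dvd hqp (hplmem hqp) hKolq.2.2.1, hFrob4q,
      inertiaDeg_eq_two_of_span_isPrime h2K hqp hKolq.2.2.2.2.1 (hplmem hqp) hqw, hRel.2, hM⟩
  · -- (tr): the (V44)-socket at the deep own primes
    intro v hvt 𝔓 h𝔓 F c₀ hF hc₀ hFc₀
    obtain ⟨q, hqf, h⟩ := Finset.mem_image.mp hvt
    obtain ⟨hq, hqd⟩ := Finset.mem_filter.mp hqf
    have hqp : q.Prime := Nat.prime_of_mem_primeFactors hq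
    rw [hpl hqp] at h
    have hv : v = primesEquiv.symm ⟨q, hqp⟩ := (Sum.inr_injective h).symm
    exact hTr (n * ℓ') d' Z hsq hGr' hZ v q (by rw [hpf']; exact Finset.mem_insert_of_mem hq) (hv ▸ hplmem hqp) hqd.2.1 hqd.2.2
      𝔓 h𝔓 F c₀ hF hc₀ hFc₀

end Summit.BirchSwinnertonDyer.BirchSwinnertonDyer.Theorems.KolyvaginLowerTwo

end
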